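import Summits.CriticalPhenomena.PercolationContinuityZ3.Theorems.Transplant.FKConnectivityAllQForestAdjacentPathGadgetProduct
import Summits.CriticalPhenomena.PercolationContinuityZ3.Theorems.Transplant.FKConnectivityAllQForestAdjacentPathGadgetResidual
import HarnessLib

/-!
# The square-free adjacent forest node across a path-gadget separator, from the level-one sign facts of the two sides

builds on p205010 (kernel theorem, internal audit signed; external expert review pending).  No definitions, no named facts, no sorries;
standard axioms.

ASSEMBLY (memo bschramm/FROM-fk-1-g20-SEPARATOR-EXCHANGE.md §3): for a separator `S = {o, p, q} ∋ o` of `v` from `y` whose gadget is the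
PATH `{op, oq}` (both pairs free in the fibre, `pq` and no other pair inside `S`), the node's fibre inequality
`#(Fo ∩ {e, f ∈ ω}, Fo) ≤ #(Fo ∩ {e ∈ ω}, Fo ∩ {f ∈ ω})` follows from the two one-side SIGN FACTS, given as injections `J₁`
(side-1 colourings of type (`pq`, `d`) into type (`d`, `pq`), `e` in the first class) and `J₂` (side-2 colourings with `f` of type
(`pq`, `d`) into type (`d`, `pq`)):
`bad − good = bad_R − good_R` (`…SeparatorResidual`) `= bad_{R∩Res} − good_{R∩Res}` (`…PathGadgetResidual`) `≤ 0` (`…PathGadgetProduct`).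
This is the kernel form of the rank-one identity `bad − good = −2·x₁(d,pq)·x₂(d,pq)` turned into an inequality transfer: the first
theorem of the lineage deriving the node's INEQUALITY (not an equality) across a separator from statements about the sides alone.
* **`adjForestNoSq_fibre_of_pathGadget_injections`**.
[cite: SempleWelsh2008, Conj. 1.1 (p. 2)] [cite: Linusson2011, Prop. 2.6] [cite: Grimmett2006, §3.8 (pp. 61–62); §4.2 Lemma (4.13)]
-/

noncomputable section

namespace Summit.CriticalPhenomena.PercolationContinuityZ3.Theorems

namespace FK

open Set SimpleGraph Literature.Probability.LatticeModels Literature.Probability.Percolation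
open scoped Classical

variable {V : Type*} [Fintype V]

section PathGadgetAssembly

open scoped symmDiff

variable {E₁ E₂ : Set (Sym2 V)} {V₁ V₂ : Set V} {M u₀ : BondConfig V} {o p q v y : V}

/-- **The node across a path-gadget separator from the two one-side sign facts** (memo §3).  Geometry and hypotheses as in
`adjForestNoSq_fibre_pathGadget_res_le`; conclusion: the fibre inequality of `FK.AdjForestRayleighNoSqOn` on the fibre
`(M ∪ {e, f}, u₀)`. [cite: SempleWelsh2008, Conj. 1.1 (p. 2)] [cite: Linusson2011, Prop. 2.6] [cite: Grimmett2006, §3.8 (pp. 61–62)] -/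
theorem adjForestNoSq_fibre_of_pathGadget_injections (hop : o ≠ p) (hoq : o ≠ q) (hpq : p ≠ q)
    (h₁ : ∀ e ∈ E₁, ∀ z ∈ e, z ∈ V₁) (h₂ : ∀ e ∈ E₂, ∀ z ∈ e, z ∈ V₂) (hS : V₁ ∩ V₂ ⊆ ({o, p, q} : Set V))
    (hd : Disjoint E₁ E₂) (hn₁ : ∀ x ∈ ({o, p, q} : Set V), ∀ x' ∈ ({o, p, q} : Set V), s(x, x') ∉ E₁)
    (hn₂ : ∀ x ∈ ({o, p, q} : Set V), ∀ x' ∈ ({o, p, q} : Set V), s(x, x') ∉ E₂)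
    (heE : s(o, v) ∈ E₁) (hfE : s(o, y) ∈ E₂)
    (hM' : insert s(o, y) (insert s(o, v) M) ∪ u₀ ⊆ ({s(o, p), s(o, q)} : Set (Sym2 V)) ∪ (E₁ ∪ E₂))
    (hgp : s(o, p) ∈ insert s(o, y) (insert s(o, v) M)) (hgq : s(o, q) ∈ insert s(o, y) (insert s(o, v) M))
    (Rset Res : Set (BondConfig V))
    (hRset : ∀ ω, ω ∈ Rset ↔
      ((¬ ∀ x ∈ ({o, p, q} : Set V), ∀ x' ∈ ({o, p, q} : Set V),
        (openGraph (ω ∩ E₁)).Reachable x x' ↔ (openGraph ((ω ∆ insert s(o, y) (insert s(o, v) M)) ∩ E₁)).Reachable x x') ∧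
      (¬ ∀ x ∈ ({o, p, q} : Set V), ∀ x' ∈ ({o, p, q} : Set V),
        (openGraph (ω ∩ E₂)).Reachable x x' ↔ (openGraph ((ω ∆ insert s(o, y) (insert s(o, v) M)) ∩ E₂)).Reachable x x')))
    (hRes : ∀ ω, ω ∈ Res ↔
      (((openGraph (ω ∩ E₂)).Reachable p q ∧ (openGraph ((ω ∆ insert s(o, y) (insert s(o, v) M)) ∩ E₁)).Reachable p q) ∨
      ((openGraph (ω ∩ E₁)).Reachable p q ∧ (openGraph ((ω ∆ insert s(o, y) (insert s(o, v) M)) ∩ E₂)).Reachable p q)))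
    (T₁ T₁' : Set (BondConfig V))
    (hT₁ : ∀ X, X ∈ T₁ ↔ X ⊆ E₁ ∧ X \ (insert s(o, y) (insert s(o, v) M) ∩ E₁) = u₀ ∩ E₁ ∧ IsForestCfg X ∧
      IsForestCfg (X ∆ (insert s(o, y) (insert s(o, v) M) ∩ E₁)) ∧ s(o, v) ∈ X ∧
      ((openGraph X).Reachable p q ∧ ¬ (openGraph X).Reachable o p ∧ ¬ (openGraph X).Reachable o q) ∧
      (∀ x ∈ ({o, p, q} : Set V), ∀ x' ∈ ({o, p, q} : Set V),
        (openGraph (X ∆ (insert s(o, y) (insert s(o, v) M) ∩ E₁))).Reachable x x' → x = x'))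
    (hT₁' : ∀ X, X ∈ T₁' ↔ X ⊆ E₁ ∧ X \ (insert s(o, y) (insert s(o, v) M) ∩ E₁) = u₀ ∩ E₁ ∧ IsForestCfg X ∧
      IsForestCfg (X ∆ (insert s(o, y) (insert s(o, v) M) ∩ E₁)) ∧ s(o, v) ∈ X ∧
      (∀ x ∈ ({o, p, q} : Set V), ∀ x' ∈ ({o, p, q} : Set V), (openGraph X).Reachable x x' → x = x') ∧
      ((openGraph (X ∆ (insert s(o, y) (insert s(o, v) M) ∩ E₁))).Reachable p q ∧
        ¬ (openGraph (X ∆ (insert s(o, y) (insert s(o, v) M) ∩ E₁))).Reachable o p ∧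
        ¬ (openGraph (X ∆ (insert s(o, y) (insert s(o, v) M) ∩ E₁))).Reachable o q))
    (T₂ T₂' : Set (BondConfig V))
    (hT₂ : ∀ Y, Y ∈ T₂ ↔ Y ⊆ E₂ ∧ Y \ (insert s(o, y) (insert s(o, v) M) ∩ E₂) = u₀ ∩ E₂ ∧ IsForestCfg Y ∧
      IsForestCfg (Y ∆ (insert s(o, y) (insert s(o, v) M) ∩ E₂)) ∧ s(o, y) ∈ Y ∧
      ((openGraph Y).Reachable p q ∧ ¬ (openGraph Y).Reachable o p ∧ ¬ (openGraph Y).Reachable o q) ∧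
      (∀ x ∈ ({o, p, q} : Set V), ∀ x' ∈ ({o, p, q} : Set V),
        (openGraph (Y ∆ (insert s(o, y) (insert s(o, v) M) ∩ E₂))).Reachable x x' → x = x'))
    (hT₂' : ∀ Y, Y ∈ T₂' ↔ Y ⊆ E₂ ∧ Y \ (insert s(o, y) (insert s(o, v) M) ∩ E₂) = u₀ ∩ E₂ ∧ IsForestCfg Y ∧
      IsForestCfg (Y ∆ (insert s(o, y) (insert s(o, v) M) ∩ E₂)) ∧ s(o, y) ∈ Y ∧
      (∀ x ∈ ({o, p, q} : Set V), ∀ x' ∈ ({o, p, q} : Set V), (openGraph Y).Reachable x x' → x = x') ∧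
      ((openGraph (Y ∆ (insert s(o, y) (insert s(o, v) M) ∩ E₂))).Reachable p q ∧
        ¬ (openGraph (Y ∆ (insert s(o, y) (insert s(o, v) M) ∩ E₂))).Reachable o p ∧
        ¬ (openGraph (Y ∆ (insert s(o, y) (insert s(o, v) M) ∩ E₂))).Reachable o q))
    (J₁ J₂ : BondConfig V → BondConfig V) (hJ₁ : ∀ X ∈ T₁, J₁ X ∈ T₁') (hJ₁i : InjOn J₁ T₁)
    (hJ₂ : ∀ Y ∈ T₂, J₂ Y ∈ T₂') (hJ₂i : InjOn J₂ T₂) :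
    fibreCount (insert s(o, y) (insert s(o, v) M)) u₀ (forestEv V ∩ {ω | s(o, v) ∈ ω ∧ s(o, y) ∈ ω}) (forestEv V) ≤
      fibreCount (insert s(o, y) (insert s(o, v) M)) u₀ (forestEv V ∩ {ω | s(o, v) ∈ ω}) (forestEv V ∩ {ω | s(o, y) ∈ ω}) := by
  have hES : ∀ e ∈ ({s(o, p), s(o, q)} : Set (Sym2 V)), ∀ z ∈ e, z ∈ ({o, p, q} : Set V) := pathGadget_on_S
  have hd₁ : Disjoint ({s(o, p), s(o, q)} : Set (Sym2 V)) E₁ := pathGadget_disjoint_of_noPair hn₁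
  have hd₂ : Disjoint ({s(o, p), s(o, q)} : Set (Sym2 V)) E₂ := pathGadget_disjoint_of_noPair hn₂
  -- (1) the inequality lives on the residual colourings
  have h1 := adjForestNoSq_fibre_residual h₁ h₂ hES hS hd hd₁ hd₂ heE hfE hM' Rsetᶜ (fun ω => by
    rw [mem_compl_iff, hRset, not_and_or, not_not, not_not, or_comm])
  rw [compl_compl] at h1
  -- (2) on the residual colourings it lives on the doubly-`pq` ones
  have h2 := adjForestNoSq_fibre_pathGadget_residual hop hoq hpq h₁ h₂ hS hd hn₁ hn₂ heE hfE hM' hgp hgq Rset Res hRset hRes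
  -- (3) the doubly-`pq` part, from the two injections
  have h3 := adjForestNoSq_fibre_pathGadget_res_le hop hoq hpq h₁ h₂ hS hd hn₁ hn₂ heE hfE hM' hgp hgq Rset Res hRset hRes T₁ T₁' hT₁ hT₁' T₂ T₂'
    hT₂ hT₂' J₁ J₂ hJ₁ hJ₁i hJ₂ hJ₂i
  omega

/-- **The same from the two SIGN FACTS as counting inequalities** (`|T₁| ≤ |T₁'|`, `|T₂| ≤ |T₂'|`, i.e. `n₁(pq,d) ≤ n₁(d,pq)` and
`n₂(pq,d; f) ≤ n₂(d,pq; f)` — the level-one sign facts `x₁(d,pq) ≥ 0`, `x₂(d,pq) ≥ 0` of memo §3): injections exist by finiteness.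
[cite: SempleWelsh2008, Conj. 1.1 (p. 2)] [cite: Linusson2011, Prop. 2.6] -/
theorem adjForestNoSq_fibre_of_pathGadget_signFacts (hop : o ≠ p) (hoq : o ≠ q) (hpq : p ≠ q)
    (h₁ : ∀ e ∈ E₁, ∀ z ∈ e, z ∈ V₁) (h₂ : ∀ e ∈ E₂, ∀ z ∈ e, z ∈ V₂) (hS : V₁ ∩ V₂ ⊆ ({o, p, q} : Set V))
    (hd : Disjoint E₁ E₂) (hn₁ : ∀ x ∈ ({o, p, q} : Set V), ∀ x' ∈ ({o, p, q} : Set V), s(x, x') ∉ E₁)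
    (hn₂ : ∀ x ∈ ({o, p, q} : Set V), ∀ x' ∈ ({o, p, q} : Set V), s(x, x') ∉ E₂)
    (heE : s(o, v) ∈ E₁) (hfE : s(o, y) ∈ E₂)
    (hM' : insert s(o, y) (insert s(o, v) M) ∪ u₀ ⊆ ({s(o, p), s(o, q)} : Set (Sym2 V)) ∪ (E₁ ∪ E₂))
    (hgp : s(o, p) ∈ insert s(o, y) (insert s(o, v) M)) (hgq : s(o, q) ∈ insert s(o, y) (insert s(o, v) M))
    (Rset Res : Set (BondConfig V))
    (hRset : ∀ ω, ω ∈ Rset ↔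
      ((¬ ∀ x ∈ ({o, p, q} : Set V), ∀ x' ∈ ({o, p, q} : Set V),
        (openGraph (ω ∩ E₁)).Reachable x x' ↔ (openGraph ((ω ∆ insert s(o, y) (insert s(o, v) M)) ∩ E₁)).Reachable x x') ∧
      (¬ ∀ x ∈ ({o, p, q} : Set V), ∀ x' ∈ ({o, p, q} : Set V),
        (openGraph (ω ∩ E₂)).Reachable x x' ↔ (openGraph ((ω ∆ insert s(o, y) (insert s(o, v) M)) ∩ E₂)).Reachable x x')))
    (hRes : ∀ ω, ω ∈ Res ↔
      (((openGraph (ω ∩ E₂)).Reachable p q ∧ (openGraph ((ω ∆ insert s(o, y) (insert s(o, v) M)) ∩ E₁)).Reachable p q) ∨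
      ((openGraph (ω ∩ E₁)).Reachable p q ∧ (openGraph ((ω ∆ insert s(o, y) (insert s(o, v) M)) ∩ E₂)).Reachable p q)))
    (T₁ T₁' : Set (BondConfig V))
    (hT₁ : ∀ X, X ∈ T₁ ↔ X ⊆ E₁ ∧ X \ (insert s(o, y) (insert s(o, v) M) ∩ E₁) = u₀ ∩ E₁ ∧ IsForestCfg X ∧
      IsForestCfg (X ∆ (insert s(o, y) (insert s(o, v) M) ∩ E₁)) ∧ s(o, v) ∈ X ∧
      ((openGraph X).Reachable p q ∧ ¬ (openGraph X).Reachable o p ∧ ¬ (openGraph X).Reachable o q) ∧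
      (∀ x ∈ ({o, p, q} : Set V), ∀ x' ∈ ({o, p, q} : Set V),
        (openGraph (X ∆ (insert s(o, y) (insert s(o, v) M) ∩ E₁))).Reachable x x' → x = x'))
    (hT₁' : ∀ X, X ∈ T₁' ↔ X ⊆ E₁ ∧ X \ (insert s(o, y) (insert s(o, v) M) ∩ E₁) = u₀ ∩ E₁ ∧ IsForestCfg X ∧
      IsForestCfg (X ∆ (insert s(o, y) (insert s(o, v) M) ∩ E₁)) ∧ s(o, v) ∈ X ∧
      (∀ x ∈ ({o, p, q} : Set V), ∀ x' ∈ ({o, p, q} : Set V), (openGraph X).Reachable x x' → x = x') ∧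
      ((openGraph (X ∆ (insert s(o, y) (insert s(o, v) M) ∩ E₁))).Reachable p q ∧
        ¬ (openGraph (X ∆ (insert s(o, y) (insert s(o, v) M) ∩ E₁))).Reachable o p ∧
        ¬ (openGraph (X ∆ (insert s(o, y) (insert s(o, v) M) ∩ E₁))).Reachable o q))
    (T₂ T₂' : Set (BondConfig V))
    (hT₂ : ∀ Y, Y ∈ T₂ ↔ Y ⊆ E₂ ∧ Y \ (insert s(o, y) (insert s(o, v) M) ∩ E₂) = u₀ ∩ E₂ ∧ IsForestCfg Y ∧
      IsForestCfg (Y ∆ (insert s(o, y) (insert s(o, v) M) ∩ E₂)) ∧ s(o, y) ∈ Y ∧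
      ((openGraph Y).Reachable p q ∧ ¬ (openGraph Y).Reachable o p ∧ ¬ (openGraph Y).Reachable o q) ∧
      (∀ x ∈ ({o, p, q} : Set V), ∀ x' ∈ ({o, p, q} : Set V),
        (openGraph (Y ∆ (insert s(o, y) (insert s(o, v) M) ∩ E₂))).Reachable x x' → x = x'))
    (hT₂' : ∀ Y, Y ∈ T₂' ↔ Y ⊆ E₂ ∧ Y \ (insert s(o, y) (insert s(o, v) M) ∩ E₂) = u₀ ∩ E₂ ∧ IsForestCfg Y ∧
      IsForestCfg (Y ∆ (insert s(o, y) (insert s(o, v) M) ∩ E₂)) ∧ s(o, y) ∈ Y ∧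
      (∀ x ∈ ({o, p, q} : Set V), ∀ x' ∈ ({o, p, q} : Set V), (openGraph Y).Reachable x x' → x = x') ∧
      ((openGraph (Y ∆ (insert s(o, y) (insert s(o, v) M) ∩ E₂))).Reachable p q ∧
        ¬ (openGraph (Y ∆ (insert s(o, y) (insert s(o, v) M) ∩ E₂))).Reachable o p ∧
        ¬ (openGraph (Y ∆ (insert s(o, y) (insert s(o, v) M) ∩ E₂))).Reachable o q))
    (hle₁ : T₁.ncard ≤ T₁'.ncard) (hle₂ : T₂.ncard ≤ T₂'.ncard) :
    fibreCount (insert s(o, y) (insert s(o, v) M)) u₀ (forestEv V ∩ {ω | s(o, v) ∈ ω ∧ s(o, y) ∈ ω}) (forestEv V) ≤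
      fibreCount (insert s(o, y) (insert s(o, v) M)) u₀ (forestEv V ∩ {ω | s(o, v) ∈ ω}) (forestEv V ∩ {ω | s(o, y) ∈ ω}) := by
  have e₁ : T₁.encard ≤ T₁'.encard := by
    rw [← Set.Finite.cast_ncard_eq (Set.toFinite _), ← Set.Finite.cast_ncard_eq (Set.toFinite _)]; exact_mod_cast hle₁
  have e₂ : T₂.encard ≤ T₂'.encard := by
    rw [← Set.Finite.cast_ncard_eq (Set.toFinite _), ← Set.Finite.cast_ncard_eq (Set.toFinite _)]; exact_mod_cast hle₂
  obtain ⟨J₁, hJ₁, hJ₁i⟩ := (Set.toFinite T₁).exists_injOn_of_encard_le e₁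
  obtain ⟨J₂, hJ₂, hJ₂i⟩ := (Set.toFinite T₂).exists_injOn_of_encard_le e₂
  exact adjForestNoSq_fibre_of_pathGadget_injections hop hoq hpq h₁ h₂ hS hd hn₁ hn₂ heE hfE hM' hgp hgq Rset Res hRset hRes T₁ T₁' hT₁ hT₁' T₂ T₂' hT₂ hT₂' J₁ J₂ (fun X hX => hJ₁ hX) hJ₁i
    (fun Y hY => hJ₂ hY) hJ₂i

end PathGadgetAssembly

end FK

end Summit.CriticalPhenomena.PercolationContinuityZ3.Theorems

end
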